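import Literature.MathematicalPhysics.QuantumFieldTheory.BalabanImbrieJaffe1984to88.BIJ88Ineq5144EndChainDecay
import Literature.MathematicalPhysics.QuantumFieldTheory.BalabanImbrieJaffe1984to88.BIJ88EndPolyFluct309

/-!
# `BalabanImbrieJaffe1984to88.BIJ88Ineq5144EndPolyDecay` — T. Bałaban, J. Imbrie, A. Jaffe, *Effective action and cluster properties of the
abelian Higgs model*, Commun. Math. Phys. **114** (1988) 257–315 [BalabanImbrieJaffe1988], Sect. 5.14 (5.14.4) p. 309 [PDF 53] with Sect. 5.13
p. 305–307 [PDF 49–51] and [Balaban1982Higgs2] (2.28)–(2.29) p. 563: **(5.14.4), LOCATED, ON END-DECORATED POLYMERS OF ANY SIZE** — the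
three-cube chain of `BIJ88Ineq5144EndChainDecay` generalized to `|X_β| ≥ 3` ARBITRARY on the same mechanism: the polymer `X″` (any number of
cubes) contains the decorated cube `□_a` (interaction slots only; every other cube of `X″` slot-free) and a FAR cube `□_n` not coupled to `□_a`;
with the SOURCELESS class `ℱ = 0`, the letters of the chain instance (Δ ≻ 0, Δ ≥ m·1, cube-local slots, `|V_Y| ≤ K_Y ≤ K₁`, `≤ G` slots per cube,
clause (ii) `K_Y e^{2GK₁} ≤ θ^{1+β′}/2`, the V-half of the vacuum clause, W, R), the decay letter (b) for the restricted interpolated inverse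
UNIFORM in `s ∈ [0,1]^I` supported in `X″`, the polymer's geometry clause (the sites of `□_n` and of `X″`-cubes coupled to `□_n` are `≥ 1` cube
side from the sites of `X″`-cubes coupled to `□_a`), and a regime clause WEAKER THAN PRINT'S PER-CUBE COUNT — only ONE decay factor `δ²`
(from `ds ≥ 1`) is asked to pay `θ^{β′}` for EVERY undecorated cube but one (print, p. 307, pays each cube crossed by its own factor `e^{−cr(e_k)}`:
*"These control the sum over walks and partitions, and the factorials, as in [9]."*), so the clause `2^{|X″|−1}·W·R·(|X″|Wc₁δR)²/m ≤
θ^{β′(|X″|−2)}` grows with `|X″|` and the class is of BOUNDED SIZE for fixed letters (owner r16 2026-08-23T09:33Z; the SIZE-UNIFORM version keeping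
`δ^{ds}` at cube depth is `BIJ88Ineq5144EndChainNDecay`, p36 g20) —

  `|locAct (□∘γ) g₃ (H, X″)| ≤ θ^{|H| + β′·|X″ ∖ □(γ(H))|}`      (`ineq5144_locAct_endPoly_of_decay`).

θ-ACCOUNTING: (D) `H ≠ ∅` (labels in `□_a`, `|X″∖□(γ(H))| = |X″| − 1`): `θ^{|H|}` and ONE `θ^{β′}` (the located surplus `a(Y) = 1`) ← clause (ii);
`θ^{β′(|X″|−2)}` ← the decay (`2^{|X″|−1}·M ≤ θ^{β′(|X″|−2)}`, the regime clause absorbing the corner-sum combinatorics `2^{|X″|−1}`).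
(V) `H = ∅` (`|X″∖□(γ(H))| = |X″|`): `θ^{2β′}` ← the vacuum clause; `θ^{β′(|X″|−2)}` ← the decay.  DECLARED BOOKKEEPING DIVERGENCE as in the chain
file: print's walk pays every undecorated cube; here one cube's factor comes from (ii) (resp. the vacuum clause).

(v1.1 DOC-ONLY, referee docfix D-g71-2 / owner 09:33Z flag: the regime clause's label corrected from «in print's form» to «weaker than print's
per-cube count: one δ² from ds ≥ 1», bounded-size class said; declarations byte-identical to v1 p360617.)

statement-level skeleton of published theorems with citation tags; proofs where landed; nothing here is a claim about the Yang–Mills mass gap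

PDF held: `paper:balaban1988-cmp114-bij-abelian-higgs-effective-action` (journal page = PDF page + 256); p. 309 (p0053 L14–16) and p. 307 (p0051) as
quoted in `BIJ88Ineq5144EndChainDecay`.

WHAT IS PROVED (unit `lit-balaban-p36`, generation 19 of the Phase-2 proof seat p36; SKELETON rows C2.Eq5.14.3-5.14.4 (flip item) / C2.Eq5.14.5 (C1
xref) of `HOME/lit-balaban-r16/ROWS-C2-part2.md`, owner r16; 0 definitions, 0 `Prop` facts, theorems only).
* `bookkeeping_nonempty_poly`, `bookkeeping_empty_poly`, **`ineq5144_locAct_endPoly_of_decay`** (engine `BIJ88ActInFarCube309.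
  abs_actIn_le_of_condMean_fluct` with `BIJ88EndPolyFluct309.fluct_le_poly` and the slot lemmas of `BIJ88Ineq5144EndChainDecay`).
HONEST SCOPE: sourceless end-decorated polymers with a far cube and the geometry clause (collinear-type geometry; it fails for polymers in which a
site of an undecorated cube touches both `□_a` and `□_n`); χ-decorated cubes, middle decorations and sources are NOT covered.  Imports
`BIJ88Ineq5144EndChainDecay`, `BIJ88EndPolyFluct309` (p36 g19); modifies nothing.  NOT summit progress; NOT continuum; NOT Clay.  Cell `lit-balaban`
Phase 2, seat p36 gen 19 (owner r16, referee ref-5).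
-/

noncomputable section

open Finset MeasureTheory Matrix Function Filter
open Literature.MathematicalPhysics.QuantumFieldTheory.Balaban1983to89
open Literature.MathematicalPhysics.QuantumFieldTheory.BalabanImbrieJaffe1984to88
open B2Eq228Conditioning (In Out resIn resOut glue blkIn blkMix condShift)
open BIJ88Sect5Statements (CutoffProfile)
open BIJ88DirichletForms305 (interpForm interpForm_posDef quadForm_interpForm_ge)
open BIJ88PolymerRep5134 (corner)
open BIJ88PolymerRep5134GaussWitness (corner_mem_cube)
open BIJ88Expansion5143Gauss (fD fD_local)
open BIJ88SlotMomentsGauss308 (uD)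
open BIJ88SlotConnectedGraph310 (uD_local)
open BIJ88Eq5145CornerModel (slotB slotY)
open BIJ88Eq5145CornerUrsell (cubeIn)
open BIJ88W6PrimeVsupp (actIn)
open BIJ88Ineq5144Located (locAct locAct_of_loc locAct_of_not_loc)
open BIJ88SecondOrder5133 (num Dfun)
open BIJ88ActInFarCube309 (abs_actIn_le_of_condMean_fluct)
open BIJ88EndChainFluct309 (exists_quadForm_le)
open BIJ88EndPolyFluct309 (fluct_le_poly)
open BIJ88Ineq5144EndChainDecay (fD_eq_one_of_free measurable_fD_of_inr abs_fD_le_of_inr abs_fD_empty_sub_one_le)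

namespace Literature.MathematicalPhysics.QuantumFieldTheory.BalabanImbrieJaffe1984to88.BIJ88Ineq5144EndPolyDecay

/-! ## §1 Exponent bookkeeping for `|X″|` cubes -/

/-- decorated polymer of `k` cubes: `2^{k−1}·(2·(θ^{1+β′}/2)^h·M) ≤ θ^{h + β′(k−1)}` when `h ≥ 1` and `2^{k−1}M ≤ θ^{β′(k−2)}`.
[cite: BalabanImbrieJaffe1988, (5.14.4) p.309] -/
theorem bookkeeping_nonempty_poly {θ β' M : ℝ} (hθ0 : 0 < θ) (hθ1 : θ ≤ 1) (hβ : 0 ≤ β') {h k : ℕ} (hh : 1 ≤ h) (hM0 : 0 ≤ M)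
    (hreg : 2 ^ (k - 1) * M ≤ θ ^ (β' * ((k : ℝ) - 2))) :
    (2 : ℝ) ^ (k - 1) * (2 * (θ ^ (1 + β') / 2) ^ h * M) ≤ θ ^ ((h : ℝ) + β' * ((k : ℝ) - 1)) := by
  have hθp : 0 < θ ^ (1 + β') := Real.rpow_pos_of_pos hθ0 _
  have h2h : (2 : ℝ) ≤ 2 ^ h := by
    calc (2 : ℝ) = 2 ^ 1 := (pow_one _).symm
      _ ≤ 2 ^ h := pow_le_pow_right₀ (by norm_num) hh
  have hhalf : (θ ^ (1 + β') / 2) ^ h ≤ (θ ^ (1 + β')) ^ h / 2 := by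
    rw [div_pow]; exact div_le_div_of_nonneg_left (pow_nonneg hθp.le _) (by norm_num) h2h
  have hstep : (θ ^ (1 + β')) ^ h = θ ^ ((1 + β') * h) := by rw [← Real.rpow_natCast, ← Real.rpow_mul hθ0.le]
  have hh' : (1 : ℝ) ≤ h := by exact_mod_cast hh
  calc (2 : ℝ) ^ (k - 1) * (2 * (θ ^ (1 + β') / 2) ^ h * M) = 2 * (θ ^ (1 + β') / 2) ^ h * (2 ^ (k - 1) * M) := by ring
    _ ≤ 2 * ((θ ^ (1 + β')) ^ h / 2) * θ ^ (β' * ((k : ℝ) - 2)) :=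
        mul_le_mul (mul_le_mul_of_nonneg_left hhalf (by norm_num)) hreg (mul_nonneg (pow_nonneg (by norm_num) _) hM0)
          (mul_nonneg (by norm_num) (div_nonneg (pow_nonneg hθp.le _) (by norm_num)))
    _ = θ ^ ((1 + β') * h) * θ ^ (β' * ((k : ℝ) - 2)) := by rw [hstep]; ring
    _ = θ ^ ((1 + β') * h + β' * ((k : ℝ) - 2)) := by rw [← Real.rpow_add hθ0]
    _ ≤ θ ^ ((h : ℝ) + β' * ((k : ℝ) - 1)) :=
        Real.rpow_le_rpow_of_exponent_ge hθ0 hθ1 (by nlinarith [mul_nonneg hβ (sub_nonneg.2 hh')])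

/-- vacuum polymer of `k` cubes: `2^{k−1}·(2·(θ^{2β′}/2)·M) ≤ θ^{β′k}` when `2^{k−1}M ≤ θ^{β′(k−2)}`. [cite: BalabanImbrieJaffe1988, (5.14.4) p.309] -/
theorem bookkeeping_empty_poly {θ β' M : ℝ} (hθ0 : 0 < θ) {k : ℕ} (hreg : 2 ^ (k - 1) * M ≤ θ ^ (β' * ((k : ℝ) - 2))) :
    (2 : ℝ) ^ (k - 1) * (2 * (θ ^ (2 * β') / 2) * M) ≤ θ ^ ((0 : ℝ) + β' * (k : ℝ)) := by
  have h0 : 0 ≤ θ ^ (2 * β') := Real.rpow_nonneg hθ0.le _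
  calc (2 : ℝ) ^ (k - 1) * (2 * (θ ^ (2 * β') / 2) * M) = θ ^ (2 * β') * (2 ^ (k - 1) * M) := by ring
    _ ≤ θ ^ (2 * β') * θ ^ (β' * ((k : ℝ) - 2)) := mul_le_mul_of_nonneg_left hreg h0
    _ = θ ^ ((0 : ℝ) + β' * (k : ℝ)) := by rw [← Real.rpow_add hθ0]; congr 1; ring

/-! ## §2 (5.14.4), located, on end-decorated polymers of any size -/

section Main

variable {α I : Type} [Fintype α] [DecidableEq α] [Fintype I] [DecidableEq I] (blk : α → I) (Δ : Matrix α α ℝ) (ℱ : α → ℝ)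
variable (adj : I → I → Prop) [DecidableRel adj]
variable (χ : CutoffProfile) {ι υ : Type} [DecidableEq ι] [DecidableEq υ]
variable (p ek : ℝ) (B : Finset ι) (Φ : ι → (α → ℝ) → ℝ) (c : ι → ℝ) (Ys : Finset υ) (V : υ → (α → ℝ) → ℝ)
variable (cube : ↥B ⊕ ↥Ys → I)

/-- **(5.14.4) LOCATED ON AN END-DECORATED POLYMER OF ANY SIZE WITH A FAR CUBE** — see the module docstring for the class, the letters and the
accounting; `X″ ∋ a, n`, `□_a` the decorated cube (interaction slots only), every other cube of `X″` slot-free, `□_n` far (not coupled to `□_a`),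
`Λ = {x | □x ≠ a}` the conditioning set, `Λ′` the corner of the precision. [cite: BalabanImbrieJaffe1988, (5.14.4) p.309; p.307 (Sect. 5.13)] -/
theorem ineq5144_locAct_endPoly_of_decay [Fintype ι] [Fintype υ]
    (hΔ : Δ.PosDef) {m : ℝ} (hm : 0 < m) (hΔm : ∀ φ : α → ℝ, m * (φ ⬝ᵥ φ) ≤ φ ⬝ᵥ (Δ *ᵥ φ))
    (hΦloc : ∀ b : B, ∀ φ ψ : α → ℝ, (∀ x, blk x = cube (Sum.inl b) → φ x = ψ x) → Φ b φ = Φ b ψ)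
    (hVloc : ∀ Y : Ys, ∀ φ ψ : α → ℝ, (∀ x, blk x = cube (Sum.inr Y) → φ x = ψ x) → V Y φ = V Y ψ)
    (hV : ∀ Y ∈ Ys, Measurable (V Y)) {KY : υ → ℝ} (hK : ∀ Y ∈ Ys, ∀ φ, |V Y φ| ≤ KY Y)
    {K₁ : ℝ} (hK₁0 : 0 ≤ K₁) (hK₁ : ∀ Y ∈ Ys, KY Y ≤ K₁) {G : ℕ} (hG : ∀ i, (univ.filter fun τ : ↥B ⊕ ↥Ys => cube τ = i).card ≤ G)
    {θ β' : ℝ} (hθ0 : 0 < θ) (hθ1 : θ ≤ 1) (hβ : 0 ≤ β')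
    (hvac : Real.exp (2 * G * K₁) - 1 ≤ θ ^ (2 * β') / 2) (hKθ₂ : ∀ Y ∈ Ys, KY Y * Real.exp (2 * G * K₁) ≤ θ ^ (1 + β') / 2)
    {W : ℕ} (hW : ∀ i, (univ.filter fun x : α => blk x = i).card ≤ W)
    {R : ℝ} (hR0 : 0 ≤ R) (hR : ∀ x, ∑ y ∈ univ.filter (fun y => blk y ≠ blk x), |Δ x y| ≤ R)
    -- the class: the sourceless end-decorated polymer `X″` with a far cube `n`
    (hℱ : ℱ = 0) (X'' : Finset I) {a n : I} (haX : a ∈ X'') (hnX : n ∈ X'') (han : a ≠ n) (haV : ∀ b' : ↥B, cube (Sum.inl b') ≠ a)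
    (hfree : ∀ τ : ↥B ⊕ ↥Ys, cube τ ∈ X'' → cube τ = a) (hfar : ∀ x y, blk x = n → blk y = a → Δ x y = 0)
    -- the decay letter (b), the polymer geometry, the regime clause
    (ds : α → α → ℕ) {c₁ δ : ℝ} (hc₁ : 0 ≤ c₁) (hδ0 : 0 ≤ δ) (hδ1 : δ ≤ 1)
    (hgeo : ∀ x l, (blk x = n ∨ (blk x ∈ X'' ∧ ∃ y, blk y = n ∧ Δ y x ≠ 0)) → (blk l ∈ X'' ∧ ∃ k, blk k = a ∧ Δ l k ≠ 0) → 1 ≤ ds x l)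
    (Λc X : Finset I)
    (hdec : ∀ s : I → ℝ, (∀ l, 0 ≤ s l ∧ s l ≤ 1) → (∀ l, l ∉ X'' → s l = 0) →
      ∀ x l : In (fun x => blk x ≠ a),
        |(blkIn (fun x => blk x ≠ a) (interpForm blk (interpForm blk Δ (corner ℝ Λc)) s))⁻¹ x l| ≤ c₁ * δ ^ ds x.1 l.1)
    (hreg : 2 ^ (X''.card - 1) * (W * R * (((X''.card * W) * (c₁ * δ * R)) ^ 2 * m⁻¹)) ≤ θ ^ (β' * ((X''.card : ℝ) - 2)))
    {t : ℝ} (ht0 : 0 ≤ t) (ht1 : t ≤ 1) {L : Type} [DecidableEq L] (γ : L → ↥(slotB B Ys cube X) ⊕ ↥(slotY B Ys cube X)) (H : Finset L) :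
    |locAct (cubeIn cube X ∘ γ) (actIn blk Δ ℱ adj χ p ek B Φ c Ys V cube Λc X t γ) H X''| ≤
      θ ^ ((H.card : ℝ) + β' * ((X'' \ H.image (cubeIn cube X ∘ γ)).card : ℝ)) := by
  subst hℱ
  by_cases hloc : ∀ j ∈ H, (cubeIn cube X ∘ γ) j ∈ X''
  swap
  · rw [locAct_of_not_loc hloc, abs_zero]
    exact Real.rpow_nonneg hθ0.le _
  rw [locAct_of_loc hloc]
  have h2 : 2 ≤ X''.card := Finset.one_lt_card.2 ⟨a, haX, n, hnX, han⟩
  -- every slot located in the polymer sits at `□_a`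
  have hslot : ∀ τ : ↥(slotB B Ys cube X) ⊕ ↥(slotY B Ys cube X), cubeIn cube X τ ∈ X'' → cubeIn cube X τ = a := by
    intro τ hτ
    rcases τ with b' | Y
    · exact hfree _ hτ
    · exact hfree _ hτ
  have hHa : ∀ j ∈ H, cubeIn cube X (γ j) = a := fun j hj => hslot _ (hloc j hj)
  have hfreei : ∀ i ∈ X'', i ≠ a → ∀ τ : ↥B ⊕ ↥Ys, cube τ ≠ i := fun i hi hia τ hτ =>
    hia ((hfree τ (hτ ▸ hi)).symm.trans hτ).symm
  -- the observable of the polymer is the decorated cube's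
  have hprod : ∀ ψ : α → ℝ, ∏ i ∈ X'',
      fD (uD χ p ek (slotB B Ys cube X) (fun b : ↥B => Φ b) (fun b : ↥B => c b) (slotY B Ys cube X) (fun Y : ↥Ys => V Y) t)
        (cubeIn cube X) γ H i ψ =
      fD (uD χ p ek (slotB B Ys cube X) (fun b : ↥B => Φ b) (fun b : ↥B => c b) (slotY B Ys cube X) (fun Y : ↥Ys => V Y) t)
        (cubeIn cube X) γ H a ψ := fun ψ =>
    prod_eq_single_of_mem a haX fun i hi hia => fD_eq_one_of_free χ p ek B Φ c Ys V cube X t γ (hfreei i hi hia) H ψ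
  -- the engine's hypotheses
  have hcs := corner_mem_cube (I := I) Λc
  have hΔc : (interpForm blk Δ (corner ℝ Λc)).PosDef := interpForm_posDef blk hΔ hcs
  have hmΔc : ∀ φ : α → ℝ, m * (φ ⬝ᵥ φ) ≤ φ ⬝ᵥ (interpForm blk Δ (corner ℝ Λc) *ᵥ φ) := quadForm_interpForm_ge blk hΔm hcs
  obtain ⟨Cu, hCu⟩ := exists_quadForm_le (interpForm blk Δ (corner ℝ Λc))
  have hf : ∀ i (φ ψ : α → ℝ), (∀ x, blk x = i → φ x = ψ x) →
      fD (uD χ p ek (slotB B Ys cube X) (fun b : ↥B => Φ b) (fun b : ↥B => c b) (slotY B Ys cube X) (fun Y : ↥Ys => V Y) t)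
        (cubeIn cube X) γ H i φ =
      fD (uD χ p ek (slotB B Ys cube X) (fun b : ↥B => Φ b) (fun b : ↥B => c b) (slotY B Ys cube X) (fun Y : ↥Ys => V Y) t)
        (cubeIn cube X) γ H i ψ := fun i φ ψ h =>
    fD_local blk γ (uD_local blk χ (cubeIn cube X) (fun b' φ ψ h => hΦloc b'.1 φ ψ h) (fun Y φ ψ h => hVloc Y.1 φ ψ h) t) H i φ ψ h
  have hfm : Measurable fun ψ : α → ℝ => ∏ i ∈ X'',
      fD (uD χ p ek (slotB B Ys cube X) (fun b : ↥B => Φ b) (fun b : ↥B => c b) (slotY B Ys cube X) (fun Y : ↥Ys => V Y) t)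
        (cubeIn cube X) γ H i ψ := by
    rw [show (fun ψ : α → ℝ => ∏ i ∈ X'',
        fD (uD χ p ek (slotB B Ys cube X) (fun b : ↥B => Φ b) (fun b : ↥B => c b) (slotY B Ys cube X) (fun Y : ↥Ys => V Y) t)
          (cubeIn cube X) γ H i ψ) = fun ψ =>
        fD (uD χ p ek (slotB B Ys cube X) (fun b : ↥B => Φ b) (fun b : ↥B => c b) (slotY B Ys cube X) (fun Y : ↥Ys => V Y) t)
          (cubeIn cube X) γ H a ψ from funext hprod]
    exact measurable_fD_of_inr χ p ek B Φ c Ys V cube X t γ haV hV H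
  have hlocP : ∀ φ ψ : α → ℝ, (∀ x, ¬ (fun x => blk x ≠ a) x → φ x = ψ x) →
      (∏ i ∈ X'',
        fD (uD χ p ek (slotB B Ys cube X) (fun b : ↥B => Φ b) (fun b : ↥B => c b) (slotY B Ys cube X) (fun Y : ↥Ys => V Y) t)
          (cubeIn cube X) γ H i φ) =
      ∏ i ∈ X'',
        fD (uD χ p ek (slotB B Ys cube X) (fun b : ↥B => Φ b) (fun b : ↥B => c b) (slotY B Ys cube X) (fun Y : ↥Ys => V Y) t)
          (cubeIn cube X) γ H i ψ := fun φ ψ h => by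
    rw [hprod, hprod]
    exact hf a φ ψ fun x hx => h x (not_ne_iff.2 hx)
  have hPn : ∀ x, blk x = n → (fun x => blk x ≠ a) x := fun x hx h => han (h.symm.trans hx)
  have hfar' : ∀ x y, blk x = n → ¬ (fun x => blk x ≠ a) y → Δ x y = 0 := fun x y hx hy => hfar x y hx (not_ne_iff.1 hy)
  have hM0 : 0 ≤ W * R * (((X''.card * W) * (c₁ * δ * R)) ^ 2 * m⁻¹) :=
    mul_nonneg (mul_nonneg (Nat.cast_nonneg _) hR0) (mul_nonneg (sq_nonneg _) (inv_nonneg.2 hm.le))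
  have hexpG : Real.exp (G * K₁) ≤ Real.exp (2 * G * K₁) :=
    Real.exp_le_exp.2 (by nlinarith [mul_nonneg (Nat.cast_nonneg G) hK₁0])
  rcases H.eq_empty_or_nonempty with rfl | hHne
  · -- the vacuum polymer: `c₀ = 1`, `K₀ = θ^{2β′}/2`
    have hK0 : ∀ ψ : α → ℝ, |(∏ i ∈ X'',
        fD (uD χ p ek (slotB B Ys cube X) (fun b : ↥B => Φ b) (fun b : ↥B => c b) (slotY B Ys cube X) (fun Y : ↥Ys => V Y) t)
          (cubeIn cube X) γ ∅ i ψ) - 1| ≤ θ ^ (2 * β') / 2 := fun ψ => by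
      rw [hprod]
      refine (abs_fD_empty_sub_one_le χ p ek B Φ c Ys V cube X t γ haV hK hK₁0 hK₁ hG ht0 ht1 ψ).trans ?_
      linarith
    have hb := abs_actIn_le_of_condMean_fluct blk Δ 0 adj χ p ek B Φ c Ys V cube Λc X t γ ∅ h2 hΔc hm hmΔc hCu hf hfm 1 hK0
      (fun x => blk x ≠ a) hlocP hnX hPn hfar'
      (fun s hs hs0 => fluct_le_poly blk hΔ hm hΔm han X'' hfar hW hR0 hR ds hc₁ hδ0 hδ1 hgeo Λc hs hs0 (hdec s hs hs0))
    refine hb.trans ?_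
    rw [card_empty, image_empty, sdiff_empty]
    push_cast
    exact bookkeeping_empty_poly hθ0 hreg
  · -- the decorated polymers: `c₀ = 0`, `K₀ = (θ^{1+β′}/2)^{|H|}`
    have hk : 1 ≤ H.card := by have := card_pos.2 hHne; omega
    have hκ : ∀ Y ∈ Ys, KY Y ≤ θ ^ (1 + β') / 2 / Real.exp (2 * G * K₁) := fun Y hY =>
      (le_div_iff₀ (Real.exp_pos _)).2 (hKθ₂ Y hY)
    have hθp : 0 ≤ θ ^ (1 + β') / 2 := div_nonneg (Real.rpow_nonneg hθ0.le _) (by norm_num)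
    have hκ0 : 0 ≤ θ ^ (1 + β') / 2 / Real.exp (2 * G * K₁) := div_nonneg hθp (Real.exp_pos _).le
    have hE1 : 1 ≤ Real.exp (2 * G * K₁) :=
      Real.one_le_exp (mul_nonneg (mul_nonneg (by norm_num) (Nat.cast_nonneg _)) hK₁0)
    have hK0 : ∀ ψ : α → ℝ, |(∏ i ∈ X'',
        fD (uD χ p ek (slotB B Ys cube X) (fun b : ↥B => Φ b) (fun b : ↥B => c b) (slotY B Ys cube X) (fun Y : ↥Ys => V Y) t)
          (cubeIn cube X) γ H i ψ) - 0| ≤ (θ ^ (1 + β') / 2) ^ H.card := fun ψ => by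
      rw [sub_zero, hprod]
      refine (abs_fD_le_of_inr χ p ek B Φ c Ys V cube X t γ haV hK hK₁0 hK₁ hG ht0 ht1 hκ0 hκ H hHa ψ).trans ?_
      rw [div_pow, div_mul_eq_mul_div, div_le_iff₀ (pow_pos (Real.exp_pos _) _)]
      exact mul_le_mul_of_nonneg_left (hexpG.trans (le_self_pow₀ hE1 (by omega))) (pow_nonneg hθp _)
    have hb := abs_actIn_le_of_condMean_fluct blk Δ 0 adj χ p ek B Φ c Ys V cube Λc X t γ H h2 hΔc hm hmΔc hCu hf hfm 0 hK0
      (fun x => blk x ≠ a) hlocP hnX hPn hfar'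
      (fun s hs hs0 => fluct_le_poly blk hΔ hm hΔm han X'' hfar hW hR0 hR ds hc₁ hδ0 hδ1 hgeo Λc hs hs0 (hdec s hs hs0))
    refine hb.trans ?_
    -- `a ∈ □(γ(H))`, so at most `|X″| − 1` undecorated cubes
    have hcard : ((X'' \ H.image (cubeIn cube X ∘ γ)).card : ℝ) ≤ (X''.card : ℝ) - 1 := by
      obtain ⟨j, hj⟩ := hHne
      have ha : a ∈ H.image (cubeIn cube X ∘ γ) := mem_image.2 ⟨j, hj, hHa j hj⟩
      have hsub : X'' \ H.image (cubeIn cube X ∘ γ) ⊆ X''.erase a := by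
        intro i hi
        rw [Finset.mem_sdiff] at hi
        exact mem_erase.2 ⟨fun h => hi.2 (h ▸ ha), hi.1⟩
      have hc : (X'' \ H.image (cubeIn cube X ∘ γ)).card + 1 ≤ X''.card := by
        calc (X'' \ H.image (cubeIn cube X ∘ γ)).card + 1 ≤ (X''.erase a).card + 1 := Nat.add_le_add_right (card_le_card hsub) 1
          _ = X''.card := card_erase_add_one haX
      have hc' : ((X'' \ H.image (cubeIn cube X ∘ γ)).card : ℝ) + 1 ≤ (X''.card : ℝ) := by exact_mod_cast hc
      linarith
    calc _ ≤ θ ^ ((H.card : ℝ) + β' * ((X''.card : ℝ) - 1)) := bookkeeping_nonempty_poly hθ0 hθ1 hβ hk hM0 hreg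
      _ ≤ _ := Real.rpow_le_rpow_of_exponent_ge hθ0 hθ1 (by nlinarith [hcard, hβ])

end Main

end Literature.MathematicalPhysics.QuantumFieldTheory.BalabanImbrieJaffe1984to88.BIJ88Ineq5144EndPolyDecay

end
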